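import Summits.ValiantsHypothesis.ValiantsHypothesis.Theorems.DepthWindowHomRel
import Summits.ValiantsHypothesis.ValiantsHypothesis.Theorems.DepthWindowDualityHalvingProof
import HarnessLib
import HarnessLib.Audit

/-!
# DepthWindow — iterating «homogenise at slope `p/q`, then halve by duality»: after
`2q(⌊log₂ Δ₀⌋ + 1)` rounds the product depth is constant and the size is `X^{E^T}`

Decomposition workshop decomp-valiant, lens 2 (gen 33), CALLED offer O7 (critic bus 898), STAGE 2,
first half (pure bookkeeping, over `ℂ`).  Fix a hypothetical homogenisation `HomAt p q c₀ a`
(`DepthWindowHomRel`): every circuit of product depth `Δ` for a homogeneous `f` of degree `d` has an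
every-gate-homogeneous circuit of depth `≤ ⌊pΔ/q⌋ + c₀` and size `≤ (s+|σ|+2)^a·2^{a d²}`.  Composing
with the PROVED duality halving `dualityHalvingAt_eight : DualityHalvingAt 8`
(`DepthWindowDualityHalvingProof`, lens 4 g17: homogeneous depth `Δ'` ↦ general depth
`≤ (Δ'+1)/2`, size `(s+|σ|+2)^8·2^{8d}`) gives ONE ROUND (`round_step`): general depth
`Δ ↦ (⌊pΔ/q⌋ + c₀ + 1)/2`, which is a strict contraction as soon as `p < 2q`.

* `depthSeq`, `sizeSeq` — the two recursions; `iterate` — `t` rounds exist.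
* decay (`p < 2q`): `2q·Δ_{s+1} ≤ (2q-1)·Δ_s + q(c₀+1)`; over a block of `2q` rounds
  (`two_mul_pred_pow_le : 2(m-1)^m ≤ m^m`, two binomial terms; cf. the tree's
  `TriangularDimersDivisionEasy.Negative.two_mul_pow_le`) `2·Δ_{s+2q} ≤ Δ_s + 4q²(c₀+1)`; hence
  `Δ_{2q·i} ≤ Δ₀/2^i + 4q²(c₀+1)` and `depthSeq_le_const : Δ_{2q(⌊log₂Δ₀⌋+1)} ≤ 4q²(c₀+1)`.
* growth: if `s, |σ|+2, 2^{d²} ≤ X` and `X ≥ 2` then one round costs `≤ X^{24(a+1)}`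
  (`sizeSeq_succ_le`), so `t` rounds cost `≤ X^{(24(a+1))^t}` (`sizeSeq_le_pow`).
* `iterate_to_const` — the packaged statement used by `DepthWindowNotHomAtBelowTwo`.

References: LimayeSrinivasanTavenas2021 (Lemma 11: the factor `2` this file iterates against);
GKKS2016 / Saxena2008 duality (as formalised in `DepthWindowDualityHalvingProof`).
-/

noncomputable section

open MvPolynomial

-- the summit and the problem share the name `ValiantsHypothesis` (D-0017 single-conjunct layout)
set_option linter.dupNamespace false

namespace Summit.ValiantsHypothesis.ValiantsHypothesis.Theorems.DepthWindowHomAtIterate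

open Literature.Computability.AlgebraicComplexity ArithCircuit
open Summit.ValiantsHypothesis.ValiantsHypothesis.Theorems.DepthWindow

/-! ### One round -/

/-- **One round**: homogenise at slope `p/q` (hypothesis `HomAt p q c₀ a`), then halve the product
depth by duality (`DualityHalvingAt 8`, proved in the tree).
[cite: LimayeSrinivasanTavenas2021, Lemma 11] -/
theorem round_step {p q c₀ a : ℕ} (hH : HomAt p q c₀ a) (hT : DualityHalvingAt 8)
    {σ : Type} [Fintype σ] {d : ℕ} {f : MvPolynomial σ ℂ} (hf : f.IsHomogeneous d)
    {D : ArithCircuit ℂ σ} (hD : D.Computes f) :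
    ∃ D' : ArithCircuit ℂ σ, D'.Computes f ∧
      D'.productDepth ≤ (p * D.productDepth / q + c₀ + 1) / 2 ∧
      D'.size ≤ ((D.size + Fintype.card σ + 2) ^ a * 2 ^ (a * d * d) + Fintype.card σ + 2) ^ 8 *
        2 ^ (8 * d) := by
  obtain ⟨D₁, hD₁, hD₁hom, hD₁d, hD₁s⟩ := hH σ d f hf D hD
  obtain ⟨D₂, hD₂, hD₂d, hD₂s⟩ := hT σ d f hf D₁ hD₁hom hD₁
  refine ⟨D₂, hD₂, hD₂d.trans (Nat.div_le_div_right (Nat.add_le_add_right hD₁d 1)),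
    hD₂s.trans ?_⟩
  exact Nat.mul_le_mul_right _
    (Nat.pow_le_pow_left (Nat.add_le_add_right (Nat.add_le_add_right hD₁s _) _) 8)

/-! ### The two recursions -/

/-- Product depth after `t` rounds: `Δ₀`, then `Δ ↦ (⌊pΔ/q⌋ + c₀ + 1)/2`.
[cite: LimayeSrinivasanTavenas2021, Lemma 11] -/
def depthSeq (p q c₀ Δ₀ : ℕ) : ℕ → ℕ
  | 0 => Δ₀
  | t + 1 => (p * depthSeq p q c₀ Δ₀ t / q + c₀ + 1) / 2

/-- Size after `t` rounds: `s₀`, then `s ↦ ((s+N+2)^a·2^{a d²} + N + 2)^8 · 2^{8d}`.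
[cite: LimayeSrinivasanTavenas2021, Lemma 11] -/
def sizeSeq (a N d s₀ : ℕ) : ℕ → ℕ
  | 0 => s₀
  | t + 1 => ((sizeSeq a N d s₀ t + N + 2) ^ a * 2 ^ (a * d * d) + N + 2) ^ 8 * 2 ^ (8 * d)

/-- `depthSeq` is monotone in the initial depth. [cite: LimayeSrinivasanTavenas2021, Lemma 11] -/
theorem depthSeq_mono {p q c₀ Δ₀ Δ₀' : ℕ} (h : Δ₀ ≤ Δ₀') (t : ℕ) :
    depthSeq p q c₀ Δ₀ t ≤ depthSeq p q c₀ Δ₀' t := by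
  induction t with
  | zero => exact h
  | succ t ih =>
    show (p * depthSeq p q c₀ Δ₀ t / q + c₀ + 1) / 2 ≤
      (p * depthSeq p q c₀ Δ₀' t / q + c₀ + 1) / 2
    exact Nat.div_le_div_right (Nat.add_le_add_right (Nat.add_le_add_right
      (Nat.div_le_div_right (Nat.mul_le_mul_left p ih)) c₀) 1)

/-- `sizeSeq` is monotone in the initial size. [cite: LimayeSrinivasanTavenas2021, Lemma 11] -/
theorem sizeSeq_mono {a N d s₀ s₀' : ℕ} (h : s₀ ≤ s₀') (t : ℕ) :
    sizeSeq a N d s₀ t ≤ sizeSeq a N d s₀' t := by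
  induction t with
  | zero => exact h
  | succ t ih =>
    show ((sizeSeq a N d s₀ t + N + 2) ^ a * 2 ^ (a * d * d) + N + 2) ^ 8 * 2 ^ (8 * d) ≤
      ((sizeSeq a N d s₀' t + N + 2) ^ a * 2 ^ (a * d * d) + N + 2) ^ 8 * 2 ^ (8 * d)
    exact Nat.mul_le_mul_right _ (Nat.pow_le_pow_left (Nat.add_le_add_right (Nat.add_le_add_right
      (Nat.mul_le_mul_right _ (Nat.pow_le_pow_left (Nat.add_le_add_right
        (Nat.add_le_add_right ih _) _) _)) _) _) _)

/-- **`t` rounds exist.** [cite: LimayeSrinivasanTavenas2021, Lemma 11] -/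
theorem iterate {p q c₀ a : ℕ} (hH : HomAt p q c₀ a) (hT : DualityHalvingAt 8)
    {σ : Type} [Fintype σ] {d : ℕ} {f : MvPolynomial σ ℂ} (hf : f.IsHomogeneous d)
    {D : ArithCircuit ℂ σ} (hD : D.Computes f) (t : ℕ) :
    ∃ D' : ArithCircuit ℂ σ, D'.Computes f ∧
      D'.productDepth ≤ depthSeq p q c₀ D.productDepth t ∧
      D'.size ≤ sizeSeq a (Fintype.card σ) d D.size t := by
  induction t with
  | zero => exact ⟨D, hD, le_rfl, le_rfl⟩
  | succ t ih =>
    obtain ⟨D₁, hD₁, hD₁d, hD₁s⟩ := ih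
    obtain ⟨D₂, hD₂, hD₂d, hD₂s⟩ := round_step hH hT hf hD₁
    refine ⟨D₂, hD₂, hD₂d.trans ?_, hD₂s.trans ?_⟩
    · show (p * D₁.productDepth / q + c₀ + 1) / 2 ≤
        (p * depthSeq p q c₀ D.productDepth t / q + c₀ + 1) / 2
      exact Nat.div_le_div_right (Nat.add_le_add_right (Nat.add_le_add_right
        (Nat.div_le_div_right (Nat.mul_le_mul_left p hD₁d)) c₀) 1)
    · show ((D₁.size + Fintype.card σ + 2) ^ a * 2 ^ (a * d * d) + Fintype.card σ + 2) ^ 8 *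
          2 ^ (8 * d) ≤
        ((sizeSeq a (Fintype.card σ) d D.size t + Fintype.card σ + 2) ^ a * 2 ^ (a * d * d) +
          Fintype.card σ + 2) ^ 8 * 2 ^ (8 * d)
      exact Nat.mul_le_mul_right _ (Nat.pow_le_pow_left (Nat.add_le_add_right
        (Nat.add_le_add_right (Nat.mul_le_mul_right _ (Nat.pow_le_pow_left (Nat.add_le_add_right
          (Nat.add_le_add_right hD₁s _) _) _)) _) _) _)

/-! ### Decay of the depth when `p < 2q` -/

/-- One step of the depth recursion, cleared of divisions:
`2q·Δ_{s+1} ≤ (2q-1)·Δ_s + q(c₀+1)`. [cite: LimayeSrinivasanTavenas2021, Lemma 11] -/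
theorem two_q_mul_depthSeq_succ_le {p q c₀ Δ₀ : ℕ} (hp : p < 2 * q) (s : ℕ) :
    2 * q * depthSeq p q c₀ Δ₀ (s + 1) ≤ (2 * q - 1) * depthSeq p q c₀ Δ₀ s + q * (c₀ + 1) := by
  show 2 * q * ((p * depthSeq p q c₀ Δ₀ s / q + c₀ + 1) / 2) ≤ _
  set x := depthSeq p q c₀ Δ₀ s
  have h1 : 2 * ((p * x / q + c₀ + 1) / 2) ≤ p * x / q + c₀ + 1 := Nat.mul_div_le _ 2
  have h2 : q * (p * x / q) ≤ p * x := Nat.mul_div_le _ q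
  have h3 : p * x ≤ (2 * q - 1) * x := Nat.mul_le_mul_right x (by omega)
  calc 2 * q * ((p * x / q + c₀ + 1) / 2) = q * (2 * ((p * x / q + c₀ + 1) / 2)) := by ring
    _ ≤ q * (p * x / q + c₀ + 1) := Nat.mul_le_mul_left q h1
    _ = q * (p * x / q) + q * (c₀ + 1) := by ring
    _ ≤ (2 * q - 1) * x + q * (c₀ + 1) := Nat.add_le_add_right (h2.trans h3) _

/-- `j` steps of the depth recursion: `(2q)^j Δ_{t+j} ≤ (2q-1)^j Δ_t + (2q)^j · j · q(c₀+1)`.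
[cite: LimayeSrinivasanTavenas2021, Lemma 11] -/
theorem pow_mul_depthSeq_add_le {p q c₀ Δ₀ : ℕ} (hp : p < 2 * q) (t j : ℕ) :
    (2 * q) ^ j * depthSeq p q c₀ Δ₀ (t + j) ≤
      (2 * q - 1) ^ j * depthSeq p q c₀ Δ₀ t + (2 * q) ^ j * j * (q * (c₀ + 1)) := by
  induction j with
  | zero => simp
  | succ j ih =>
    have hstep := two_q_mul_depthSeq_succ_le (c₀ := c₀) (Δ₀ := Δ₀) hp (t + j)
    have hq : 0 < 2 * q := by omega
    set K := q * (c₀ + 1)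
    set D0 := depthSeq p q c₀ Δ₀ t
    set Dj := depthSeq p q c₀ Δ₀ (t + j)
    have hadd : t + (j + 1) = t + j + 1 := rfl
    rw [hadd]
    set Dj1 := depthSeq p q c₀ Δ₀ (t + j + 1)
    have h1 : (2 * q - 1) * ((2 * q) ^ j * j * K) ≤ (2 * q) * ((2 * q) ^ j * j * K) :=
      Nat.mul_le_mul_right _ (Nat.sub_le _ _)
    have h2 : (2 * q) ^ j * K ≤ (2 * q) ^ (j + 1) * K :=
      Nat.mul_le_mul_right _ (Nat.pow_le_pow_right hq (Nat.le_succ j))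
    calc (2 * q) ^ (j + 1) * Dj1 = (2 * q) ^ j * (2 * q * Dj1) := by ring
      _ ≤ (2 * q) ^ j * ((2 * q - 1) * Dj + K) := Nat.mul_le_mul_left _ hstep
      _ = (2 * q - 1) * ((2 * q) ^ j * Dj) + (2 * q) ^ j * K := by ring
      _ ≤ (2 * q - 1) * ((2 * q - 1) ^ j * D0 + (2 * q) ^ j * j * K) + (2 * q) ^ j * K :=
          Nat.add_le_add_right (Nat.mul_le_mul_left _ ih) _
      _ = (2 * q - 1) ^ (j + 1) * D0 +
            ((2 * q - 1) * ((2 * q) ^ j * j * K) + (2 * q) ^ j * K) := by ring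
      _ ≤ (2 * q - 1) ^ (j + 1) * D0 +
            ((2 * q) * ((2 * q) ^ j * j * K) + (2 * q) ^ (j + 1) * K) :=
          Nat.add_le_add_left (Nat.add_le_add h1 h2) _
      _ = (2 * q - 1) ^ (j + 1) * D0 + (2 * q) ^ (j + 1) * (j + 1) * K := by ring

/-- `2·(m-1)^m ≤ m^m` for `m ≥ 1`, i.e. `(1 - 1/m)^m ≤ 1/2`.
[cite: LimayeSrinivasanTavenas2021, Lemma 11] -/
theorem two_mul_pred_pow_le {m : ℕ} (hm : 1 ≤ m) : 2 * (m - 1) ^ m ≤ m ^ m := by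
  obtain ⟨x, rfl⟩ : ∃ x, m = x + 1 := ⟨m - 1, by omega⟩
  rw [Nat.add_sub_cancel]
  -- two terms of the binomial expansion of `(x+1)^(x+1)`
  have h := add_pow x 1 (x + 1)
  rw [Finset.sum_range_succ, Finset.sum_range_succ] at h
  simp only [one_pow, mul_one, Nat.choose_self, Nat.choose_succ_self_right, Nat.cast_id,
    Nat.sub_self, Nat.add_sub_cancel_left] at h
  have h1 : x ^ (x + 1) ≤ x ^ x * (x + 1) := by
    rw [pow_succ]; exact Nat.mul_le_mul_left _ (Nat.le_succ x)
  omega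

/-- A block of `2q` rounds at least halves the depth, up to the constant `4q²(c₀+1)`:
`2·Δ_{t+2q} ≤ Δ_t + 4q·q(c₀+1)`. [cite: LimayeSrinivasanTavenas2021, Lemma 11] -/
theorem two_mul_depthSeq_block_le {p q c₀ Δ₀ : ℕ} (hp : p < 2 * q) (t : ℕ) :
    2 * depthSeq p q c₀ Δ₀ (t + 2 * q) ≤ depthSeq p q c₀ Δ₀ t + 4 * q * (q * (c₀ + 1)) := by
  have hb := pow_mul_depthSeq_add_le (c₀ := c₀) (Δ₀ := Δ₀) hp t (2 * q)
  have hhalf : 2 * (2 * q - 1) ^ (2 * q) ≤ (2 * q) ^ (2 * q) := two_mul_pred_pow_le (by omega)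
  have hpos : 0 < (2 * q) ^ (2 * q) := pow_pos (by omega) _
  set P := (2 * q) ^ (2 * q)
  set D1 := depthSeq p q c₀ Δ₀ (t + 2 * q)
  set D0 := depthSeq p q c₀ Δ₀ t
  set K := q * (c₀ + 1)
  refine Nat.le_of_mul_le_mul_left ?_ hpos
  calc P * (2 * D1) = 2 * (P * D1) := by ring
    _ ≤ 2 * ((2 * q - 1) ^ (2 * q) * D0 + P * (2 * q) * K) := Nat.mul_le_mul_left 2 hb
    _ = (2 * (2 * q - 1) ^ (2 * q)) * D0 + P * (4 * q * K) := by ring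
    _ ≤ P * D0 + P * (4 * q * K) := Nat.add_le_add_right (Nat.mul_le_mul_right _ hhalf) _
    _ = P * (D0 + 4 * q * K) := by ring

/-- After `i` blocks: `Δ_{2q·i} ≤ Δ₀/2^i + 4q·q(c₀+1)`. [cite: LimayeSrinivasanTavenas2021, Lemma 11] -/
theorem depthSeq_blocks_le {p q c₀ Δ₀ : ℕ} (hp : p < 2 * q) (i : ℕ) :
    depthSeq p q c₀ Δ₀ (2 * q * i) ≤ Δ₀ / 2 ^ i + 4 * q * (q * (c₀ + 1)) := by
  induction i with
  | zero => simp [depthSeq]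
  | succ i ih =>
    have hb := two_mul_depthSeq_block_le (c₀ := c₀) (Δ₀ := Δ₀) hp (2 * q * i)
    rw [show 2 * q * (i + 1) = 2 * q * i + 2 * q by ring]
    have key : ∀ A D Dp K' : ℕ, 2 * D ≤ Dp + K' → Dp ≤ A + K' → D ≤ (A + 2 * K') / 2 := by
      intro A D Dp K' h1 h2; omega
    have h3 := key (Δ₀ / 2 ^ i) _ _ _ hb ih
    rw [Nat.add_mul_div_left _ _ (by norm_num : 0 < 2), Nat.div_div_eq_div_mul, ← pow_succ] at h3
    exact h3

/-- **Constant depth after `T = 2q(⌊log₂ Δ₀⌋ + 1)` rounds**: `Δ_T ≤ 4q·q(c₀+1)`.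
[cite: LimayeSrinivasanTavenas2021, Lemma 11] -/
theorem depthSeq_le_const {p q c₀ : ℕ} (hp : p < 2 * q) (Δ₀ : ℕ) :
    depthSeq p q c₀ Δ₀ (2 * q * (Nat.log 2 Δ₀ + 1)) ≤ 4 * q * (q * (c₀ + 1)) := by
  have h := depthSeq_blocks_le (c₀ := c₀) (Δ₀ := Δ₀) hp (Nat.log 2 Δ₀ + 1)
  have h0 : Δ₀ / 2 ^ (Nat.log 2 Δ₀ + 1) = 0 :=
    Nat.div_eq_of_lt (Nat.lt_pow_succ_log_self one_lt_two Δ₀)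
  rw [h0, zero_add] at h
  exact h

/-! ### Growth of the size -/

/-- The homogenisation cost against a common ceiling `X`:
`(s+N+2)^a · 2^{a d²} ≤ X^{3a}` if `s, N+2, 2^{d²} ≤ X` and `X ≥ 2`.
[cite: LimayeSrinivasanTavenas2021, Lemma 11] -/
theorem hom_cost_le {a N d s X : ℕ} (hX : 2 ≤ X) (hN : N + 2 ≤ X) (hd : 2 ^ (d * d) ≤ X)
    (hs : s ≤ X) : (s + N + 2) ^ a * 2 ^ (a * d * d) ≤ X ^ (3 * a) := by
  have h1 : s + N + 2 ≤ X ^ 2 := by nlinarith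
  have h2 : (s + N + 2) ^ a ≤ X ^ (2 * a) := by
    rw [pow_mul X 2 a]; exact Nat.pow_le_pow_left h1 a
  have h3 : 2 ^ (a * d * d) ≤ X ^ a := by
    rw [mul_assoc, pow_mul' 2 a (d * d)]
    exact Nat.pow_le_pow_left hd a
  calc (s + N + 2) ^ a * 2 ^ (a * d * d) ≤ X ^ (2 * a) * X ^ a := Nat.mul_le_mul h2 h3
    _ = X ^ (3 * a) := by ring

/-- One round against a common ceiling: `s_{t+1} ≤ X^{24(a+1)}` if `s_t, N+2, 2^{d²} ≤ X`, `X ≥ 2`.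
[cite: LimayeSrinivasanTavenas2021, Lemma 11] -/
theorem sizeSeq_succ_le {a N d s₀ X : ℕ} (hX : 2 ≤ X) (hN : N + 2 ≤ X) (hd : 2 ^ (d * d) ≤ X)
    (t : ℕ) (hs : sizeSeq a N d s₀ t ≤ X) : sizeSeq a N d s₀ (t + 1) ≤ X ^ (24 * (a + 1)) := by
  show ((sizeSeq a N d s₀ t + N + 2) ^ a * 2 ^ (a * d * d) + N + 2) ^ 8 * 2 ^ (8 * d) ≤ _
  set s := sizeSeq a N d s₀ t
  have h4 : (s + N + 2) ^ a * 2 ^ (a * d * d) ≤ X ^ (3 * a) := hom_cost_le hX hN hd hs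
  have hB : X ^ (3 * a) ≤ X ^ (3 * a + 1) := Nat.pow_le_pow_right (by omega) (by omega)
  have hXa : X ≤ X ^ (3 * a + 1) := by
    calc X = X ^ 1 := (pow_one X).symm
      _ ≤ X ^ (3 * a + 1) := Nat.pow_le_pow_right (by omega) (by omega)
  have hC : 2 * X ^ (3 * a + 1) ≤ X ^ (3 * a + 2) := by
    calc 2 * X ^ (3 * a + 1) ≤ X * X ^ (3 * a + 1) := Nat.mul_le_mul_right _ hX
      _ = X ^ (3 * a + 2) := by ring
  have h5 : (s + N + 2) ^ a * 2 ^ (a * d * d) + N + 2 ≤ X ^ (3 * a + 2) := by omega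
  have h6 : ((s + N + 2) ^ a * 2 ^ (a * d * d) + N + 2) ^ 8 ≤ X ^ (8 * (3 * a + 2)) := by
    rw [pow_mul' X 8 (3 * a + 2)]; exact Nat.pow_le_pow_left h5 8
  have h2d : 2 ^ d ≤ X := (Nat.pow_le_pow_right (by norm_num) (Nat.le_mul_self d)).trans hd
  have h7 : 2 ^ (8 * d) ≤ X ^ 8 := by
    rw [pow_mul' 2 8 d]; exact Nat.pow_le_pow_left h2d 8
  calc ((s + N + 2) ^ a * 2 ^ (a * d * d) + N + 2) ^ 8 * 2 ^ (8 * d)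
      ≤ X ^ (8 * (3 * a + 2)) * X ^ 8 := Nat.mul_le_mul h6 h7
    _ = X ^ (24 * (a + 1)) := by ring

/-- `t` rounds against a common ceiling: `s_t ≤ X^{(24(a+1))^t}`.
[cite: LimayeSrinivasanTavenas2021, Lemma 11] -/
theorem sizeSeq_le_pow {a N d s₀ X : ℕ} (hX : 2 ≤ X) (hN : N + 2 ≤ X) (hd : 2 ^ (d * d) ≤ X)
    (hs : s₀ ≤ X) (t : ℕ) : sizeSeq a N d s₀ t ≤ X ^ ((24 * (a + 1)) ^ t) := by
  induction t with
  | zero => simpa [sizeSeq] using hs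
  | succ t ih =>
    set Y := X ^ ((24 * (a + 1)) ^ t) with hY
    have hXY : X ≤ Y := by
      calc X = X ^ 1 := (pow_one X).symm
        _ ≤ X ^ ((24 * (a + 1)) ^ t) :=
            Nat.pow_le_pow_right (by omega) (Nat.one_le_pow _ _ (by omega))
    have h := sizeSeq_succ_le (a := a) (N := N) (d := d) (s₀ := s₀) (hX.trans hXY)
      (hN.trans hXY) (hd.trans hXY) t ih
    calc sizeSeq a N d s₀ (t + 1) ≤ Y ^ (24 * (a + 1)) := h
      _ = X ^ ((24 * (a + 1)) ^ (t + 1)) := by rw [hY, ← pow_mul, ← pow_succ]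

/-! ### Packaged: `T` rounds from any circuit -/

/-- **`T` rounds.**  Under `HomAt p q c₀ a` with `p < 2q` (and the proved duality halving), every
circuit `D` for a homogeneous `f` of degree `d` with `D.size, |σ|+2, 2^{d²} ≤ X` (`X ≥ 2`) and
`D.productDepth ≤ Δ₀` can be replaced by one of CONSTANT product depth `≤ 4q·q(c₀+1)` and size
`≤ X^{(24(a+1))^{2q(⌊log₂Δ₀⌋+1)}}`. [cite: LimayeSrinivasanTavenas2021, Lemma 11] -/
theorem iterate_to_const {p q c₀ a : ℕ} (hp : p < 2 * q) (hH : HomAt p q c₀ a)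
    (hT : DualityHalvingAt 8) {σ : Type} [Fintype σ] {d : ℕ} {f : MvPolynomial σ ℂ}
    (hf : f.IsHomogeneous d) {D : ArithCircuit ℂ σ} (hD : D.Computes f) {X Δ₀ : ℕ} (hX : 2 ≤ X)
    (hN : Fintype.card σ + 2 ≤ X) (hdX : 2 ^ (d * d) ≤ X) (hs : D.size ≤ X)
    (hΔ : D.productDepth ≤ Δ₀) :
    ∃ D' : ArithCircuit ℂ σ, D'.Computes f ∧ D'.productDepth ≤ 4 * q * (q * (c₀ + 1)) ∧
      D'.size ≤ X ^ ((24 * (a + 1)) ^ (2 * q * (Nat.log 2 Δ₀ + 1))) := by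
  obtain ⟨D', hD', hD'd, hD's⟩ := iterate hH hT hf hD (2 * q * (Nat.log 2 Δ₀ + 1))
  exact ⟨D', hD', hD'd.trans ((depthSeq_mono hΔ _).trans (depthSeq_le_const hp Δ₀)),
    hD's.trans (sizeSeq_le_pow hX hN hdX hs _)⟩

end Summit.ValiantsHypothesis.ValiantsHypothesis.Theorems.DepthWindowHomAtIterate
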